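import Summits.PneNP.PneNP.Theses.CanonicalForms

/-!
# Crux `NumberFieldNoCF` (stmt-PneNP-0948) — line `quadratic-slice` (skeleton; birth certificate of the open piece of
# the `PEqNotCF` split; v4 — BALANCED regime, after the seat's own cheapest-falsifier check killed v1–v3)

The degree-2 slice of "number fields have no polynomial-time canonical defining polynomial". Feed a putative
canonical defining polynomial `c ∈ FP` the quadratics `X² − N`, `N = p·q²` (`p`, `q` prime). COHERENCE forces the
output `g_p = X² + bX + e` to be the same for all `q` (all these fields are `ℚ(√p)`; compare with `q = 2`), and the
isomorphism forces `disc g_p = b² − 4e = p·r_p²` with `r_p ∈ ℤ ∖ {0}` (`ℚ(√Δ) ≅ ℚ(√p)`, `p` prime ⇒ `Δ/p` is a rational,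
hence integral, square). So `D(N) := gcd(N, |b² − 4e|)` read off `decode (c (code (X² − N)))` equals
`p·gcd(q, r_p)²`, i.e. the proper factor `p` of `N`, for every prime `q ∤ r_p`; and `|r_p| ≤ 2^{poly(n)}` for `n`-bit
`p` (the output of `c` on the `O(n)`-bit input `X² − 4p` has polynomial length), so among the `n`-bit primes `q` at
most `poly(n)` fail. Hence (`stub_quadSliceSplits`, PROVABLE: elementary algebraic number theory + `FP` plumbing) an
`FP` canonical defining polynomial yields an `FP` splitter of BALANCED moduli `p·q²` (`p`, `q` both `n`-bit) that, for
every `n`-bit prime `p`, fails on at most `n^k + k` of the `n`-bit primes `q`. The arithmetic hardness statement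
`stub_pq2SplittingHard` (OPEN) says no `FP` function does that: for every `D ∈ FP` and every `k` there are `n` and an
`n`-bit prime `p` with more than `n^k + k` failing `n`-bit primes `q` (there are `≈ 2ⁿ/n` of them). Composition
`NumberFieldNoCF_of` is kernel-checked below.

WHY BALANCED (seat's falsifier log): the unbalanced form "for every prime `p`, all but FINITELY many primes `q`" (v1–v3)
is refuted by trial division up to the bit-length of `N` (for fixed `p` it finds `p` as soon as `log₂(p q²) ≥ p`), so
its hardness half was FALSE; with `p`, `q` of the same length `n ≥ 5`, trial division finds nothing, Fermat/`⌊√N⌋`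
tricks do not apply (`p ≉ q²`), Boneh–Durfee–Howgrave-Graham factor `p^r q` in polynomial time only for `r ≳ log p`
(`r = 2` costs `2^{Θ(n)}`), and ECM/Peralta–Okamoto for `p²q` are subexponential or randomized.

Success predicate (inlined): `D` SPLITS `N` iff `1 < decodeNat (D (encodeNat N)) < N` and it divides `N` (binary numerals
`Computability.encodeNat/decodeNat`, as for the tree's `rabinFn`). Failing set: `{q < 2^(n+1) | 2^n ≤ q, q prime, ¬ SPLIT}`,
counted with `Set.ncard` (finite: bounded).
-/

set_option linter.dupNamespace false

namespace Summit.PneNP.PneNP.Cruxes.NumberFieldNoCF.QuadraticSlice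

open Summit.PneNP.PneNP.Theses.CanonicalForms

/-- **stub (PROVABLE; algebraic number theory + `FP` closure)**: an `FP` canonical defining polynomial `c` (the two
conjuncts of `NumberFieldNoCF`'s matrix as hypotheses) yields `D ∈ FP` — `D(N) := gcd(N, |b² − 4e|)` with `[e, b, 1, …]`
the decoded output of `c` on the code of `X² − N` — and an exponent `k` such that for every `n`-bit prime `p` at most
`n^k + k` of the `n`-bit primes `q` are NOT split by `D` at `N = p·q²` (the failures divide `r_p`, `disc g_p = p·r_p²`,
`|r_p| ≤ 2^{poly(n)}`). Sources: Cohen GTM 138 §4.4.2 (polred only "almost canonical"), §5.1–5.2 (quadratic fields and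
discriminants); `FP` bricks `CodeFPArith`, gcd as in `EquivalenceProblemsRabinProofs`; output-length ≤ time for `TM2`. -/
theorem stub_quadSliceSplits :
    ∀ c ∈ Literature.Computability.Complexity.FP, (∀ p : Polynomial ℤ, p.Monic → Irreducible p → ∃ l : List ℤ, Literature.Computability.Complexity.encodingIntBool.listBool.decode (c (Literature.Computability.Complexity.encodingIntBool.listBool.encode ((List.range (p.natDegree + 1)).map p.coeff))) = some l ∧ (∑ i : Fin l.length, Polynomial.monomial (i : ℕ) (l.get i)).Monic ∧ Irreducible (∑ i : Fin l.length, Polynomial.monomial (i : ℕ) (l.get i)) ∧ Nonempty (AdjoinRoot (((∑ i : Fin l.length, Polynomial.monomial (i : ℕ) (l.get i))).map (Int.castRingHom ℚ)) ≃ₐ[ℚ] AdjoinRoot ((p).map (Int.castRingHom ℚ)))) → (∀ p q : Polynomial ℤ, p.Monic → Irreducible p → q.Monic → Irreducible q → Nonempty (AdjoinRoot ((p).map (Int.castRingHom ℚ)) ≃ₐ[ℚ] AdjoinRoot ((q).map (Int.castRingHom ℚ))) → c (Literature.Computability.Complexity.encodingIntBool.listBool.encode ((List.range (p.natDegree + 1)).map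 p.coeff)) = c (Literature.Computability.Complexity.encodingIntBool.listBool.encode ((List.range (q.natDegree + 1)).map q.coeff))) → ∃ D ∈ Literature.Computability.Complexity.FP, ∃ k : ℕ, ∀ n p : ℕ, p.Prime → 2 ^ n ≤ p → p < 2 ^ (n + 1) → Set.ncard {q : ℕ | q < 2 ^ (n + 1) ∧ 2 ^ n ≤ q ∧ q.Prime ∧ ¬ (1 < Computability.decodeNat (D (Computability.encodeNat (p * q ^ 2))) ∧ Computability.decodeNat (D (Computability.encodeNat (p * q ^ 2))) < p * q ^ 2 ∧ Computability.decodeNat (D (Computability.encodeNat (p * q ^ 2))) ∣ p * q ^ 2)} ≤ n ^ k + k := by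
  sorry

/-- **stub (OPEN — arithmetic hardness of BALANCED `p·q²`)**: no polynomial-time `D` splits `p·q²` for every `n`-bit
prime `p` and all but `poly(n)` of the `n`-bit primes `q`: for every `D ∈ FP` and `k` there are `n` and an `n`-bit prime
`p` with more than `n^k + k` failing `n`-bit primes `q`. Stronger than worst-case hardness of the family (many failures
are required), far weaker than average-case hardness; the modulus family is Okamoto–Uchiyama's / EPOC's `p²q`
(doi:10.1007/bfb0054135); Boneh–Durfee–Howgrave-Graham (doi:10.1007/3-540-48405-1_21) need `r ≳ log p` for `p^r q`.
Above the summit in truth-strength (an `FP` lower bound for a total search problem), like every hardness leaf of this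
route; NOT the crux restated (integers only; probes fail). -/
theorem stub_pq2SplittingHard :
    ∀ D ∈ Literature.Computability.Complexity.FP, ∀ k : ℕ, ∃ n p : ℕ, p.Prime ∧ 2 ^ n ≤ p ∧ p < 2 ^ (n + 1) ∧ n ^ k + k < Set.ncard {q : ℕ | q < 2 ^ (n + 1) ∧ 2 ^ n ≤ q ∧ q.Prime ∧ ¬ (1 < Computability.decodeNat (D (Computability.encodeNat (p * q ^ 2))) ∧ Computability.decodeNat (D (Computability.encodeNat (p * q ^ 2))) < p * q ^ 2 ∧ Computability.decodeNat (D (Computability.encodeNat (p * q ^ 2))) ∣ p * q ^ 2)} := by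
  sorry

/-- **Seam (sorry-free): the two stub STATEMENTS give the crux's BODY** (verbatim; so that `NumberFieldNoCF_of` below
is the file's only theorem whose head is the crux NAME, which `ledger skeleton check` keys on) — a canonical `c` gives
`D, k` with at most `n^k + k` failures for every `n`-bit `p`; hardness gives `n, p` with more. -/
theorem numberFieldNoCF_of_sigs :
    (∀ c ∈ Literature.Computability.Complexity.FP, (∀ p : Polynomial ℤ, p.Monic → Irreducible p → ∃ l : List ℤ, Literature.Computability.Complexity.encodingIntBool.listBool.decode (c (Literature.Computability.Complexity.encodingIntBool.listBool.encode ((List.range (p.natDegree + 1)).map p.coeff))) = some l ∧ (∑ i : Fin l.length, Polynomial.monomial (i : ℕ) (l.get i)).Monic ∧ Irreducible (∑ i : Fin l.length, Polynomial.monomial (i : ℕ) (l.get i)) ∧ Nonempty (AdjoinRoot (((∑ i : Fin l.length, Polynomial.monomial (i : ℕ) (l.get i))).map (Int.castRingHom ℚ)) ≃ₐ[ℚ] AdjoinRoot ((p).map (Int.castRingHom ℚ)))) → (∀ p q : Polynomial ℤ, p.Monic → Irreducible p → q.Monic → Irreducible q → Nonempty (AdjoinRoot ((p).map (Int.castRingHom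 ℚ)) ≃ₐ[ℚ] AdjoinRoot ((q).map (Int.castRingHom ℚ))) → c (Literature.Computability.Complexity.encodingIntBool.listBool.encode ((List.range (p.natDegree + 1)).map p.coeff)) = c (Literature.Computability.Complexity.encodingIntBool.listBool.encode ((List.range (q.natDegree + 1)).map q.coeff))) → ∃ D ∈ Literature.Computability.Complexity.FP, ∃ k : ℕ, ∀ n p : ℕ, p.Prime → 2 ^ n ≤ p → p < 2 ^ (n + 1) → Set.ncard {q : ℕ | q < 2 ^ (n + 1) ∧ 2 ^ n ≤ q ∧ q.Prime ∧ ¬ (1 < Computability.decodeNat (D (Computability.encodeNat (p * q ^ 2))) ∧ Computability.decodeNat (D (Computability.encodeNat (p * q ^ 2))) < p * q ^ 2 ∧ Computability.decodeNat (D (Computability.encodeNat (p * q ^ 2))) ∣ p * q ^ 2)} ≤ n ^ k + k) →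
    (∀ D ∈ Literature.Computability.Complexity.FP, ∀ k : ℕ, ∃ n p : ℕ, p.Prime ∧ 2 ^ n ≤ p ∧ p < 2 ^ (n + 1) ∧ n ^ k + k < Set.ncard {q : ℕ | q < 2 ^ (n + 1) ∧ 2 ^ n ≤ q ∧ q.Prime ∧ ¬ (1 < Computability.decodeNat (D (Computability.encodeNat (p * q ^ 2))) ∧ Computability.decodeNat (D (Computability.encodeNat (p * q ^ 2))) < p * q ^ 2 ∧ Computability.decodeNat (D (Computability.encodeNat (p * q ^ 2))) ∣ p * q ^ 2)}) →
    (¬ ∃ c ∈ Literature.Computability.Complexity.FP, (∀ p : Polynomial ℤ, p.Monic → Irreducible p → ∃ l : List ℤ, Literature.Computability.Complexity.encodingIntBool.listBool.decode (c (Literature.Computability.Complexity.encodingIntBool.listBool.encode ((List.range (p.natDegree + 1)).map p.coeff))) = some l ∧ (∑ i : Fin l.length, Polynomial.monomial (i : ℕ) (l.get i)).Monic ∧ Irreducible (∑ i : Fin l.length, Polynomial.monomial (i : ℕ) (l.get i)) ∧ Nonempty (AdjoinRoot (((∑ i : Fin l.length, Polynomial.monomial (i : ℕ) (l.get i))).map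 (Int.castRingHom ℚ)) ≃ₐ[ℚ] AdjoinRoot ((p).map (Int.castRingHom ℚ)))) ∧ ∀ p q : Polynomial ℤ, p.Monic → Irreducible p → q.Monic → Irreducible q → Nonempty (AdjoinRoot ((p).map (Int.castRingHom ℚ)) ≃ₐ[ℚ] AdjoinRoot ((q).map (Int.castRingHom ℚ))) → c (Literature.Computability.Complexity.encodingIntBool.listBool.encode ((List.range (p.natDegree + 1)).map p.coeff)) = c (Literature.Computability.Complexity.encodingIntBool.listBool.encode ((List.range (q.natDegree + 1)).map q.coeff))) := by
  intro h1 h2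
  rintro ⟨c, hc, hA, hB⟩
  obtain ⟨D, hD, k, hk⟩ := h1 c hc hA hB
  obtain ⟨n, p, hp, hlo, hhi, hlt⟩ := h2 D hD k
  exact absurd (hk n p hp hlo hhi) (not_le.mpr hlt)

/-- **Composition (kernel-checked): the crux `NumberFieldNoCF` BY NAME from the two declared stubs** (the file's only
`sorry`s). -/
theorem NumberFieldNoCF_of : NumberFieldNoCF :=
  numberFieldNoCF_of_sigs stub_quadSliceSplits stub_pq2SplittingHard

end Summit.PneNP.PneNP.Cruxes.NumberFieldNoCF.QuadraticSlice
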